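import Summits.Ventures.GridStability.Models.StructurePreservingEnergy
import HarnessLib

/-!
# Signed couplings I — block energy of a frustrated triangle: quadratic minorant, harmonic rows, face value,
# strict pairing sector

Venture GRIDFUSION, G2-SCALE cell; card «idea-3 (cycle 4) / signed-coupling-triangle-absorption»
(HOME/IDEAS-G2.md § l.675; crit-1 GRADE PASS · NEW-COMBINATION, STATUS 2026-08-28T20:54:27Z); the planner's scratch
proof `HOME/idea-3/c4/BlockRoaW.lean` (sha16 ce7574047d5005c1, 2 175 lines, farm rc 0 / 0 sorry / standard axioms,
crit-1 g2 independent check STATUS l.10676) filed in content by the cell's Lean-lane seat gridfusion-sos-5 (g11), split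
into tree modules `StructurePreservingBlock{Energy,Rows,Cover,Region,Roa,Level,Toys}`; namespace renamed from
`…Ideas.TriangleAbsorption.Roa` to `…Lyapunov.StructurePreserving.SignedBlock`. 0 kit, 0 facts.
THREE COLUMNS: theorems about the MODELLED lossless structure-preserving model MV-3 with SIGNED couplings (negative
branch reactances: three-winding-transformer star equivalents, series capacitors); nothing here is a certificate for
any benchmark and nothing here certifies a real grid.

WHAT THIS MODULE SAYS (card K2, block algebra; `Sketch.lean` §1–§4, §7).  A FRUSTRATED TRIANGLE = two positive legs
`β₁, β₂` (angle deviations `x₁, x₂` from the operating point) and one NEGATIVE base `−γ` (deviation `x₁ − x₂`, KVL).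
Its block branch energy `W_K = β₁U(a₁;x₁) + β₂U(a₂;x₂) − γU(a₃;x₁−x₂)` (`U(a;x) = cos a − cos(a+x) − x sin a` = the
tree's `branchEnergy (a+x) a`) dominates the quadratic minorant `Q = m₁x₁² + m₂x₂² − (γ/2)(x₁−x₂)²` on the leg box
`|xᵢ| ≤ ρ` given per-leg chord-curvature ROWS `mᵢx² ≤ βᵢU(aᵢ;x)` and the frustrated leg's curvature majorant
`U(a;y) ≤ y²/2` (the tree's `branchEnergy_le_sq_half`); the HARMONIC ROW `(γ/2)(m₁+m₂) ≤ m₁m₂` (series–parallel rule)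
makes `Q ≥ 0`, so `W_K ≥ 0` on the box ((i)′) and `W_K ≥ F = ρ²(m₁ − γm₂/(2m₂−γ))` on the tight faces `x₁ = ±ρ`
((ii)′); the same algebra with `c = γ` and slope rows gives the strict block SECTOR of the pairing term ((iii)′).

* `U`, `P`, `blockEnergy`, `blockPairing`, `quadW`;
* `quadW_nonneg` / `quadW_pos` (harmonic rows), `quadW_face` / `face_le_quadW` / `face_formula` (completed square);
* `blockEnergy_ge_quadW`, `blockEnergy_nonneg`, `blockEnergy_face`, `pairing_le_sq`, `blockPairing_pos`;
* `U_eq_branchEnergy`, `U_le_half_sq` (= tree `branchEnergy_le_sq_half`), `blockEnergy_nonneg'`.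
-/

noncomputable section

open Set Filter Topology Real Finset
open Summit.Ventures.GridStability.Models.StructurePreserving
open Summit.Ventures.GridStability.Models.StructurePreserving.Params

namespace Summit.Ventures.GridStability.Lyapunov.StructurePreserving.SignedBlock

/-! ## §A. Block algebra and closed-form rows (card K2; planner Sketch §1–§4, §7) -/

/-- Shifted branch energy `U(a; x) = cos a − cos(a + x) − x·sin a` (the tree's `branchEnergy (a + x) a`). -/
def U (a x : ℝ) : ℝ := Real.cos a - Real.cos (a + x) - x * Real.sin a

/-- Pairing term `Π(a; x) = x·(sin(a + x) − sin a)`. -/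
def P (a x : ℝ) : ℝ := x * (Real.sin (a + x) - Real.sin a)

/-- Block energy of a triangle with positive legs `β₁, β₂` (coordinates `x₁, x₂`) and frustrated leg `−γ`
(coordinate `x₁ − x₂`, KVL). -/
def blockEnergy (β₁ β₂ γ a₁ a₂ a₃ x₁ x₂ : ℝ) : ℝ :=
  β₁ * U a₁ x₁ + β₂ * U a₂ x₂ - γ * U a₃ (x₁ - x₂)

/-- Block pairing (ray-monotonicity) term of the same triangle. -/
def blockPairing (β₁ β₂ γ a₁ a₂ a₃ x₁ x₂ : ℝ) : ℝ :=
  β₁ * P a₁ x₁ + β₂ * P a₂ x₂ - γ * P a₃ (x₁ - x₂)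

/-- The quadratic minorant `Q(x₁, x₂) = m₁x₁² + m₂x₂² − c·(x₁ − x₂)²` (`c = γ/2` for the energy, `c = γ` for the pairing). -/
def quadW (m₁ m₂ c x₁ x₂ : ℝ) : ℝ := m₁ * x₁ ^ 2 + m₂ * x₂ ^ 2 - c * (x₁ - x₂) ^ 2

/-! ### §1. The harmonic row makes the minorant nonnegative (resp. positive off the origin) -/

/-- The minorant expanded: `Q = (m₁ − c)x₁² + 2c·x₁x₂ + (m₂ − c)x₂²`. [folklore] -/
theorem quadW_eq (m₁ m₂ c x₁ x₂ : ℝ) :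
    quadW m₁ m₂ c x₁ x₂ = (m₁ - c) * x₁ ^ 2 + 2 * c * (x₁ * x₂) + (m₂ - c) * x₂ ^ 2 := by
  unfold quadW; ring

/-- HARMONIC ROW (weak): `c ≥ 0`, `m₁ ≥ c`, `m₂ ≥ c`, `m₁ m₂ ≥ c (m₁ + m₂)` ⇒ `Q ≥ 0` everywhere.
(With `c = γ/2`: `2 m₁ m₂ ≥ γ (m₁ + m₂)`, i.e. `1/m₁ + 1/m₂ ≤ 2/γ` — the series–parallel rule.) -/
theorem quadW_nonneg {m₁ m₂ c : ℝ} (hc : 0 ≤ c) (h₁ : c ≤ m₁) (h₂ : c ≤ m₂)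
    (hrow : c * (m₁ + m₂) ≤ m₁ * m₂) (x₁ x₂ : ℝ) : 0 ≤ quadW m₁ m₂ c x₁ x₂ := by
  rw [quadW_eq]
  have hdet : c ^ 2 ≤ (m₁ - c) * (m₂ - c) := by nlinarith
  rcases eq_or_lt_of_le h₁ with h | h
  · -- m₁ = c ⇒ c = 0
    have hc0 : c ^ 2 ≤ 0 := by simpa [← h] using hdet
    have : c = 0 := by nlinarith
    subst this
    have : m₁ = 0 := by linarith
    subst this
    nlinarith [sq_nonneg x₂]
  · have hA : 0 < m₁ - c := by linarith
    have key : (m₁ - c) * ((m₁ - c) * x₁ ^ 2 + 2 * c * (x₁ * x₂) + (m₂ - c) * x₂ ^ 2)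
        = ((m₁ - c) * x₁ + c * x₂) ^ 2 + ((m₁ - c) * (m₂ - c) - c ^ 2) * x₂ ^ 2 := by ring
    have hrhs : 0 ≤ ((m₁ - c) * x₁ + c * x₂) ^ 2 + ((m₁ - c) * (m₂ - c) - c ^ 2) * x₂ ^ 2 := by
      have := sq_nonneg ((m₁ - c) * x₁ + c * x₂)
      have := mul_nonneg (sub_nonneg.mpr hdet) (sq_nonneg x₂)
      linarith
    rw [← key] at hrhs
    nlinarith [hrhs, hA]

/-- HARMONIC ROW (strict): `0 ≤ c < m₁`, `c < m₂`, `c (m₁ + m₂) < m₁ m₂` ⇒ `Q > 0` off the origin. -/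
theorem quadW_pos {m₁ m₂ c : ℝ} (_hc : 0 ≤ c) (h₁ : c < m₁) (_h₂ : c < m₂)
    (hrow : c * (m₁ + m₂) < m₁ * m₂) {x₁ x₂ : ℝ} (hx : x₁ ≠ 0 ∨ x₂ ≠ 0) :
    0 < quadW m₁ m₂ c x₁ x₂ := by
  rw [quadW_eq]
  have hA : 0 < m₁ - c := by linarith
  have hdet : 0 < (m₁ - c) * (m₂ - c) - c ^ 2 := by nlinarith
  have key : (m₁ - c) * ((m₁ - c) * x₁ ^ 2 + 2 * c * (x₁ * x₂) + (m₂ - c) * x₂ ^ 2)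
      = ((m₁ - c) * x₁ + c * x₂) ^ 2 + ((m₁ - c) * (m₂ - c) - c ^ 2) * x₂ ^ 2 := by ring
  have hrhs : 0 < ((m₁ - c) * x₁ + c * x₂) ^ 2 + ((m₁ - c) * (m₂ - c) - c ^ 2) * x₂ ^ 2 := by
    rcases hx with h | h
    · by_cases h2 : x₂ = 0
      · subst h2
        have : (m₁ - c) * x₁ ≠ 0 := mul_ne_zero hA.ne' h
        have := pow_pos (abs_pos.mpr this) 2
        simp only [sq_abs] at this
        simpa using this
      · have := mul_pos hdet (pow_pos (abs_pos.mpr h2) 2)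
        rw [sq_abs] at this
        nlinarith [sq_nonneg ((m₁ - c) * x₁ + c * x₂)]
    · have := mul_pos hdet (pow_pos (abs_pos.mpr h) 2)
      rw [sq_abs] at this
      nlinarith [sq_nonneg ((m₁ - c) * x₁ + c * x₂)]
  rw [← key] at hrhs
  exact pos_of_mul_pos_right hrhs hA.le

/-! ### §2. Closed-form FACE VALUE of the block (completed square on the face `x₁ = ρ`) -/

/-- Completed square: on the face `x₁ = ρ`,
`Q(ρ, x₂) = ρ²·(m₁ − 2c·m₂/(2m₂ − 2c))·… ` — written with `c`: `Q(ρ,x₂) = ρ²(m₁ − c − c²/(m₂ − c)) + (m₂ − c)(x₂ + cρ/(m₂−c))²`. -/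
theorem quadW_face {m₁ m₂ c : ℝ} (h₂ : c < m₂) (ρ x₂ : ℝ) :
    quadW m₁ m₂ c ρ x₂
      = ρ ^ 2 * (m₁ - c - c ^ 2 / (m₂ - c)) + (m₂ - c) * (x₂ + c * ρ / (m₂ - c)) ^ 2 := by
  have hB : m₂ - c ≠ 0 := by linarith
  rw [quadW_eq]
  field_simp
  ring

/-- The face value `F₁ = ρ²(m₁ − c − c²/(m₂ − c))` (= `ρ²(m₁ − γm₂/(2m₂ − γ))` for `c = γ/2`) bounds `Q` from
below on BOTH faces `x₁ = ±ρ`. -/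
theorem face_le_quadW {m₁ m₂ c : ℝ} (h₂ : c < m₂) (ρ x₂ : ℝ) :
    ρ ^ 2 * (m₁ - c - c ^ 2 / (m₂ - c)) ≤ quadW m₁ m₂ c ρ x₂ ∧
    ρ ^ 2 * (m₁ - c - c ^ 2 / (m₂ - c)) ≤ quadW m₁ m₂ c (-ρ) x₂ := by
  have hB : 0 < m₂ - c := by linarith
  constructor
  · rw [quadW_face h₂]; nlinarith [mul_nonneg hB.le (sq_nonneg (x₂ + c * ρ / (m₂ - c)))]
  · have hsym : quadW m₁ m₂ c (-ρ) x₂ = quadW m₁ m₂ c ρ (-x₂) := by unfold quadW; ring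
    rw [hsym, quadW_face h₂]
    nlinarith [mul_nonneg hB.le (sq_nonneg (-x₂ + c * ρ / (m₂ - c)))]

/-- With `c = γ/2` the face value is the card's `ρ²(m₁ − γ m₂/(2 m₂ − γ))`. -/
theorem face_formula {m₁ m₂ γ : ℝ} (h₂ : γ / 2 < m₂) (ρ : ℝ) :
    ρ ^ 2 * (m₁ - γ / 2 - (γ / 2) ^ 2 / (m₂ - γ / 2)) = ρ ^ 2 * (m₁ - γ * m₂ / (2 * m₂ - γ)) := by
  have : 2 * m₂ - γ ≠ 0 := by linarith
  have : m₂ - γ / 2 ≠ 0 := by linarith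
  field_simp
  ring

/-! ### §3. The block energy dominates the minorant, given the per-leg ROWS -/

/-- BLOCK replacement of per-edge facts (i)/(ii).  Rows: chord-curvature minorants `mᵢ x² ≤ βᵢ U(aᵢ; x)` of the two
convex legs on `|x| ≤ ρ`, and the curvature majorant `U(a₃; y) ≤ y²/2` of the frustrated leg (true for all `y`;
from `branchEnergy_eq_integral` + `|sin u − sin v| ≤ |u − v|`, a P-item), `γ ≥ 0`. -/
theorem blockEnergy_ge_quadW {β₁ β₂ γ a₁ a₂ a₃ m₁ m₂ ρ : ℝ} (hγ : 0 ≤ γ)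
    (row₁ : ∀ x, |x| ≤ ρ → m₁ * x ^ 2 ≤ β₁ * U a₁ x)
    (row₂ : ∀ x, |x| ≤ ρ → m₂ * x ^ 2 ≤ β₂ * U a₂ x)
    (rowN : ∀ y, U a₃ y ≤ y ^ 2 / 2)
    {x₁ x₂ : ℝ} (hx₁ : |x₁| ≤ ρ) (hx₂ : |x₂| ≤ ρ) :
    quadW m₁ m₂ (γ / 2) x₁ x₂ ≤ blockEnergy β₁ β₂ γ a₁ a₂ a₃ x₁ x₂ := by
  unfold quadW blockEnergy
  have h1 := row₁ x₁ hx₁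
  have h2 := row₂ x₂ hx₂
  have h3 := mul_le_mul_of_nonneg_left (rowN (x₁ - x₂)) hγ
  nlinarith

/-- (i)′: the block energy is `≥ 0` on the box under the weak harmonic row. -/
theorem blockEnergy_nonneg {β₁ β₂ γ a₁ a₂ a₃ m₁ m₂ ρ : ℝ} (hγ : 0 ≤ γ)
    (h₁ : γ / 2 ≤ m₁) (h₂ : γ / 2 ≤ m₂) (hrow : γ / 2 * (m₁ + m₂) ≤ m₁ * m₂)
    (row₁ : ∀ x, |x| ≤ ρ → m₁ * x ^ 2 ≤ β₁ * U a₁ x)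
    (row₂ : ∀ x, |x| ≤ ρ → m₂ * x ^ 2 ≤ β₂ * U a₂ x)
    (rowN : ∀ y, U a₃ y ≤ y ^ 2 / 2)
    {x₁ x₂ : ℝ} (hx₁ : |x₁| ≤ ρ) (hx₂ : |x₂| ≤ ρ) :
    0 ≤ blockEnergy β₁ β₂ γ a₁ a₂ a₃ x₁ x₂ :=
  (quadW_nonneg (by linarith) h₁ h₂ hrow x₁ x₂).trans
    (blockEnergy_ge_quadW hγ row₁ row₂ rowN hx₁ hx₂)

/-- (ii)′: on the TIGHT faces `x₁ = ±ρ` of the box the block energy is at least the closed-form face value. -/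
theorem blockEnergy_face {β₁ β₂ γ a₁ a₂ a₃ m₁ m₂ ρ : ℝ} (hγ : 0 ≤ γ) (hρ : 0 ≤ ρ)
    (h₂ : γ / 2 < m₂)
    (row₁ : ∀ x, |x| ≤ ρ → m₁ * x ^ 2 ≤ β₁ * U a₁ x)
    (row₂ : ∀ x, |x| ≤ ρ → m₂ * x ^ 2 ≤ β₂ * U a₂ x)
    (rowN : ∀ y, U a₃ y ≤ y ^ 2 / 2)
    {x₂ : ℝ} (hx₂ : |x₂| ≤ ρ) :
    ρ ^ 2 * (m₁ - γ * m₂ / (2 * m₂ - γ)) ≤ blockEnergy β₁ β₂ γ a₁ a₂ a₃ ρ x₂ ∧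
    ρ ^ 2 * (m₁ - γ * m₂ / (2 * m₂ - γ)) ≤ blockEnergy β₁ β₂ γ a₁ a₂ a₃ (-ρ) x₂ := by
  have hρ' : |ρ| ≤ ρ := by rw [abs_of_nonneg hρ]
  have hρ'' : |-ρ| ≤ ρ := by rw [abs_neg, abs_of_nonneg hρ]
  obtain ⟨hf₁, hf₂⟩ := face_le_quadW (m₁ := m₁) h₂ ρ x₂
  rw [face_formula h₂] at hf₁ hf₂
  exact ⟨hf₁.trans (blockEnergy_ge_quadW hγ row₁ row₂ rowN hρ' hx₂),
    hf₂.trans (blockEnergy_ge_quadW hγ row₁ row₂ rowN hρ'' hx₂)⟩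

/-! ### §4. The pairing block: the frustrated leg's row is one Mathlib line; strict rows ⇒ positivity off consensus -/

/-- The frustrated leg's PAIRING majorant: `y·(sin(a + y) − sin a) ≤ y²` for all `a, y`. -/
theorem pairing_le_sq (a y : ℝ) : P a y ≤ y ^ 2 := by
  unfold P
  have h : |Real.sin (a + y) - Real.sin a| ≤ |y| := by
    simpa using Real.abs_sin_sub_sin_le (a + y) a
  calc y * (Real.sin (a + y) - Real.sin a) ≤ |y * (Real.sin (a + y) - Real.sin a)| := le_abs_self _
    _ = |y| * |Real.sin (a + y) - Real.sin a| := abs_mul _ _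
    _ ≤ |y| * |y| := mul_le_mul_of_nonneg_left h (abs_nonneg _)
    _ = y ^ 2 := by rw [← sq, sq_abs]

/-- (iii)′: BLOCK strict sector.  Rows: chord-slope minorants `pᵢ x² ≤ βᵢ Π(aᵢ; x)` on `|x| ≤ ρ` and the STRICT
harmonic row with `c = γ`; then the block pairing is `> 0` at every box point off the consensus direction
`x₁ = x₂ = 0` — so a stationary point of the energy inside the block box has equal deviations on the block,
which is what `eq_equilibrium_of_fderiv_eq_zero_vtPolytope` needs edge-by-edge today. -/
theorem blockPairing_pos {β₁ β₂ γ a₁ a₂ a₃ p₁ p₂ ρ : ℝ} (hγ : 0 ≤ γ)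
    (h₁ : γ < p₁) (h₂ : γ < p₂) (hrow : γ * (p₁ + p₂) < p₁ * p₂)
    (row₁ : ∀ x, |x| ≤ ρ → p₁ * x ^ 2 ≤ β₁ * P a₁ x)
    (row₂ : ∀ x, |x| ≤ ρ → p₂ * x ^ 2 ≤ β₂ * P a₂ x)
    {x₁ x₂ : ℝ} (hx₁ : |x₁| ≤ ρ) (hx₂ : |x₂| ≤ ρ) (hx : x₁ ≠ 0 ∨ x₂ ≠ 0) :
    0 < blockPairing β₁ β₂ γ a₁ a₂ a₃ x₁ x₂ := by
  have hQ := quadW_pos hγ h₁ h₂ hrow hx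
  have h3 := mul_le_mul_of_nonneg_left (pairing_le_sq a₃ (x₁ - x₂)) hγ
  have e1 := row₁ x₁ hx₁
  have e2 := row₂ x₂ hx₂
  unfold quadW at hQ
  unfold blockPairing
  nlinarith

/-! ### §7. The frustrated leg's curvature row `U(a; y) ≤ y²/2` (discharges `rowN` of §3) -/

/-- `U(a; x)` is the tree's shifted branch energy `branchEnergy (a + x) a`. [folklore] -/
theorem U_eq_branchEnergy (a x : ℝ) : U a x = branchEnergy (a + x) a := by
  unfold U branchEnergy; ring

/-- The frustrated leg's curvature row `U(a; y) ≤ y²/2` for all `a, y` — the tree's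
`branchEnergy_le_sq_half` (sine is 1-Lipschitz) in the shifted coordinates. [folklore] -/
theorem U_le_half_sq (a y : ℝ) : U a y ≤ y ^ 2 / 2 := by
  rw [U_eq_branchEnergy]
  simpa using branchEnergy_le_sq_half (a + y) a

/-- §3 with `rowN` discharged: the block energy is nonnegative on the box from the two convex-leg rows alone. -/
theorem blockEnergy_nonneg' {β₁ β₂ γ a₁ a₂ a₃ m₁ m₂ ρ : ℝ} (hγ : 0 ≤ γ)
    (h₁ : γ / 2 ≤ m₁) (h₂ : γ / 2 ≤ m₂) (hrow : γ / 2 * (m₁ + m₂) ≤ m₁ * m₂)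
    (row₁ : ∀ x, |x| ≤ ρ → m₁ * x ^ 2 ≤ β₁ * U a₁ x)
    (row₂ : ∀ x, |x| ≤ ρ → m₂ * x ^ 2 ≤ β₂ * U a₂ x)
    {x₁ x₂ : ℝ} (hx₁ : |x₁| ≤ ρ) (hx₂ : |x₂| ≤ ρ) :
    0 ≤ blockEnergy β₁ β₂ γ a₁ a₂ a₃ x₁ x₂ :=
  blockEnergy_nonneg hγ h₁ h₂ hrow row₁ row₂ (fun y => U_le_half_sq a₃ y) hx₁ hx₂

end Summit.Ventures.GridStability.Lyapunov.StructurePreserving.SignedBlock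

end
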